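import Summits.HodgeConjecture.HodgeConjecture.Theorems.NikulinTwinTransportHodgeSimilitudeAlgebraicAnchors
import Summits.HodgeConjecture.HodgeConjecture.Theorems.HodgeSimilitudeAlgebraic.Negative.NoAntisimilitude

/-!
# Route NikulinTwinTransport · crux `HodgeSimilitudeAlgebraic` (stmt-HodgeConjecture-13676) —
# the DIRECT characterisation: the crux at multiplier `c` IS twin transport at multiplier `c`,
# with no Buskin, no composition of correspondences, no period surjectivity

Every reduction of the crux landed so far (`hodgeSimilitudeAlgebraic_of_prime_anchors`,
`hodgeSimilitudeAlgebraic_iff_prime_twinTransport`, `…_frontier`) passes from a given rational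
Hodge similitude `ψ : H²(S′) → H²(S)` to a FIXED lattice similitude `M` through an anchor partner
`S″`, and therefore carries three debts foreign to the crux: Buskin's theorem (route item
`HodgeIsometryAlgebraic`, stmt-HodgeConjecture-13675, or its primitive `ReflAt[μ₀]`), the
composition of algebraic correspondences (`CompCorr`, i.e. the moving input `CupAlg`) and the
surjectivity of the period map (`Huybrechts_K3_periodSurjective_projective`). This file observes
that none of them is needed when the twin transport is granted for EVERY rational `c`-similitude of
the K3 lattice (which is what `RatTwinTransportAt[c]` says, and what every engine line of the crux
sets out to prove): given `ψ`, mark `S` and `S′` (`Huybrechts_K3_marking_exists`); the conjugate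
`M := η ∘ ψ ∘ η′⁻¹` is ITSELF a rational `c`-similitude of `(Λ_ℂ, k3Form)` — defined over `ℚ`
(`markingConj_intCast`), multiplying the form by `± c` (`k3Form_markingConj_signed_mul`) where the
sign `−` is excluded by the signature (`k3FormRat_no_antisimilitude`, file
`HodgeSimilitudeAlgebraic/Negative/NoAntisimilitude`), injective hence with a two-sided inverse
defined over `ℚ` — and it matches the periods (`M x′ ∈ ℂ x` because `ψ` preserves the type
`(2,0)`); the twin transport for `M` on the marked pair `(S, S′)` is literally `ψ = [γ]_*`.

Results (all sorry-free; the only named facts are `Huybrechts_K3_marking_exists` for `⇐` and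
`Huybrechts_K3_hodgeTypes_H2` for `⇒`):

* `simAlgAt_of_ratTwinTransportAt` — the crux at ANY rational multiplier `c > 0` from
  `RatTwinTransportAt[c]` and the marking fact alone;
* `simAlgAt_iff_ratTwinTransportAt`, `hodgeSimilitudeAlgebraic_iff_forall_ratTwinTransportAt` —
  THE CRUX ⟺ `∀ c > 0, RatTwinTransportAt[c]`, modulo the two Huybrechts facts only;
* `hodgeSimilitudeAlgebraic_of_nat_ratTwinTransportAt`, `…_iff_nat_…` — integer multipliers
  suffice (squares are free, `simAlgAt_div_sq`), still without Buskin or composition;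
* `twinSimilitudeAlgebraic_iff_ratTwinTransportAt_two` — the route's target X
  (stmt-HodgeConjecture-13674) ⟺ twin transport for the rational `2`-similitudes of `Λ_{K3}`;
* `hodgeIsometryAlgebraic_iff_ratTwinTransportAt_one` — Buskin's item (stmt-HodgeConjecture-13675)
  ⟺ twin transport for the rational isometries of `Λ_{K3}`.

Consequence for the crux chain: a line whose engine delivers `TwinTransportFor[M]` for all rational
`M` of multiplier `n` (as the engines of lines cm-norm-anchors / semiregular-twin-hecke-vhc are
typed) needs neither the hypothesis `hB : HodgeIsometryAlgebraic` nor a `stub_compCorr` /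
`CorrespondenceComposition` stub (blocked on `CupAlg`) in its composition theorem. Nothing here
proves a twin transport: that remains the open content (a sub-case of the Hodge conjecture for
`c ≠ 1`, Buskin's twistor theorem for `c = 1`). Sources: Buskin, J. reine angew. Math. 755 (2019)
§6.2; Varesco, Math. Z. 305 (2023) §2; Huybrechts, *Lectures on K3 Surfaces* (2016) Ch. 1
Prop. 3.5, Ch. 6 Prop. 1.2, Ch. 14 §0.3.
-/

noncomputable section

open CategoryTheory MonoidalCategory
open scoped Manifold
open Literature.AlgebraicGeometry.Motives Literature.AlgebraicGeometry.HodgeTheory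
open Literature.AlgebraicGeometry.Surfaces Literature.Geometry.Kaehler
open Literature.AlgebraicTopology.SingularHomology
open Summit.HodgeConjecture.HodgeConjecture.Theses.NikulinTwinTransport
open Summit.HodgeConjecture.HodgeConjecture.Theorems.HodgeSimilitudeAlgebraic.Negative

namespace Summit.HodgeConjecture.HodgeConjecture.Theorems.NikulinTwinTransport

/-! ### Local notations (verbatim those of the Anchors / Frontier / Primes files) -/

/-- `MarkedK3[S, η, p, x]`: a marked K3 surface with period `x`. Local notation only. -/
local notation3 (prettyPrint := false) "MarkedK3[" S ", " η ", " p ", " x "]" =>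
  (IsIntegralClass p ∧
    (∀ q : complexBetti S (2 * 2), IsIntegralClass q → ∃ n : ℤ, q = n • p) ∧
    (∀ c : complexBetti S (2 * 1), IsIntegralClass c ↔ ∃ v : K3Index → ℤ, η c = fun i => (v i : ℂ)) ∧
    (∀ a b : complexBetti S (2 * 1),
        cupProduct (rfl : 2 * 1 + 2 * 1 = 2 * 2) a b = k3Form (η a) (η b) • p) ∧
    IsOfHodgeType 2 S (2 * 1) 2 0 (LinearEquiv.symm η x) ∧
    (∀ τ : complexBetti S (2 * 1), IsOfHodgeType 2 S (2 * 1) 2 0 τ → ∃ t : ℂ, τ = t • LinearEquiv.symm η x))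

/-- `PeriodPt[x]`: a projective period point. Local notation only. -/
local notation3 (prettyPrint := false) "PeriodPt[" x "]" =>
  (k3Form x x = 0 ∧ 0 < (k3Form (star x) x).re ∧
    ∃ u : K3Index → ℤ, k3Form (fun i => (u i : ℂ)) x = 0 ∧ 0 < ∑ i, ∑ j, u i * k3Gram i j * u j)

/-- `Corr[μ, S, S', hS, hS' ; γ, y] = [γ]_* y`. Local notation only. -/
local notation3 (prettyPrint := false) "Corr[" μ ", " S ", " S' ", " hS ", " hS' " ; " γ ", " y "]" =>
  complexGysin μ
    (IsSmoothProjective.tensor_holds (IsK3Surface.isSmoothProjective hS)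
      (IsK3Surface.isSmoothProjective hS'))
    (IsK3Surface.isSmoothProjective hS) (SemiCartesianMonoidalCategory.fst S S')
    (rfl : 2 * 1 + 2 * 2 + 2 * 2 = 2 * 1 + 2 * (2 + 2))
    (cupProduct (rfl : 2 * 1 + 2 * 2 = 2 * 1 + 2 * 2)
      (complexBetti.map (SemiCartesianMonoidalCategory.snd S S') (2 * 1) y) γ)

/-- `TwinTransportFor[M]`: the twin transport for the endomorphism `M` of `Λ_ℂ`. Local notation only. -/
local notation3 (prettyPrint := false) "TwinTransportFor[" M "]" =>
  ∀ (μ : OrientationFamily), μ.HasPoincareDuality →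
    ∀ (S S' : SchemeOver ℂ) (hS : IsK3Surface S) (hS' : IsK3Surface S')
      (η : complexBetti S (2 * 1) ≃ₗ[ℂ] (K3Index → ℂ)) (p : complexBetti S (2 * 2))
      (x : K3Index → ℂ)
      (η' : complexBetti S' (2 * 1) ≃ₗ[ℂ] (K3Index → ℂ)) (p' : complexBetti S' (2 * 2))
      (x' : K3Index → ℂ),
      MarkedK3[S, η, p, x] → PeriodPt[x] → MarkedK3[S', η', p', x'] → PeriodPt[x'] →
      (∃ t : ℂ, M x' = t • x) →
      ∃ γ ∈ algebraicClasses (MonoidalCategoryStruct.tensorObj S S') 2,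
        ∀ y : complexBetti S' (2 * 1), η.symm (M (η' y)) = Corr[μ, S, S', hS, hS' ; γ, y]

/-- `RatTwinTransportAt[c]`: twin transport for every rational `c`-similitude of `Λ_ℂ` with rational
two-sided inverse. Local notation only, verbatim from the Frontier file. -/
local notation3 (prettyPrint := false) "RatTwinTransportAt[" c "]" =>
  ∀ (M N : Module.End ℂ (K3Index → ℂ)),
    (∀ v : K3Index → ℤ, ∃ w : K3Index → ℚ, M (fun i => (v i : ℂ)) = fun i => (w i : ℂ)) →
    (∀ v : K3Index → ℤ, ∃ w : K3Index → ℚ, N (fun i => (v i : ℂ)) = fun i => (w i : ℂ)) →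
    M * N = 1 → N * M = 1 → (∀ a b, k3Form (M a) (M b) = c * k3Form a b) → TwinTransportFor[M]

/-- `SimAlgAt[c]`: the crux at one multiplier `c : ℂ`. Local notation only, verbatim from the Primes
file (so that `SimAlgAt[(2 : ℂ)] ↔ TwinSimilitudeAlgebraic` and `HodgeSimilitudeAlgebraic ↔ ∀ r > 0,
SimAlgAt[(r : ℂ)]` hold by `Iff.rfl`). -/
local notation3 (prettyPrint := false) "SimAlgAt[" c "]" =>
  ∀ (μ : OrientationFamily), μ.HasPoincareDuality →
    ∀ (S S' : SchemeOver ℂ)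
      (hS : (IsSmoothProjective 2 S ∧ Subsingleton (structureSheafCohomology S.left 1) ∧
        ∃ (A : HodgeModel 2 S) (η : MForm 𝓘(ℝ, A.model) A.carrier ℂ 2),
          IsHolomorphicInCharts η ∧ ∀ x, η x ≠ 0))
      (hS' : (IsSmoothProjective 2 S' ∧ Subsingleton (structureSheafCohomology S'.left 1) ∧
        ∃ (A : HodgeModel 2 S') (η : MForm 𝓘(ℝ, A.model) A.carrier ℂ 2),
          IsHolomorphicInCharts η ∧ ∀ x, η x ≠ 0))
      (p : complexBetti S (2 * 2)) (p' : complexBetti S' (2 * 2)),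
      (IsIntegralClass p ∧ ∀ q : complexBetti S (2 * 2), IsIntegralClass q → ∃ n : ℤ, q = n • p) →
      (IsIntegralClass p' ∧
        ∀ q : complexBetti S' (2 * 2), IsIntegralClass q → ∃ n : ℤ, q = n • p') →
      ∀ (ψ : complexBetti S' (2 * 1) →ₗ[ℂ] complexBetti S (2 * 1)),
        (∀ x, IsRationalClass x → IsRationalClass (ψ x)) →
        (∀ (i j : ℕ) x, IsOfHodgeType 2 S' (2 * 1) i j x → IsOfHodgeType 2 S (2 * 1) i j (ψ x)) →
        (∀ (x y : complexBetti S' (2 * 1)) (a : ℂ),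
          cupProduct (rfl : 2 * 1 + 2 * 1 = 2 * 2) x y = a • p' →
            cupProduct (rfl : 2 * 1 + 2 * 1 = 2 * 2) (ψ x) (ψ y) = (c * a) • p) →
        ∃ γ ∈ algebraicClasses (MonoidalCategoryStruct.tensorObj S S') 2,
          ∀ x : complexBetti S' (2 * 1),
            ψ x = complexGysin μ (IsSmoothProjective.tensor_holds hS.1 hS'.1) hS.1
              (SemiCartesianMonoidalCategory.fst S S')
              (rfl : 2 * 1 + 2 * 2 + 2 * 2 = 2 * 1 + 2 * (2 + 2))
              (cupProduct (rfl : 2 * 1 + 2 * 2 = 2 * 1 + 2 * 2)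
                (complexBetti.map (SemiCartesianMonoidalCategory.snd S S') (2 * 1) x) γ)

/-! ### Two lattice lemmas: no rational anti-similitude; rational two-sided inverses -/

/-- **No rational anti-similitude of `(Λ_ℂ, k3Form)` of negative multiplier `-c`, `c > 0`**
(complexified form of `k3FormRat_no_antisimilitude`: descend `σ` to `Λ_ℚ` by
`exists_ratEnd_of_forall_intCast`). [cite: Huybrechts2016K3, Ch. 14 §0.3 (vi) (signature (3,19))] -/
theorem not_ratAntisimilitude_k3Form (c : ℚ) (hc : 0 < c) (σ : Module.End ℂ (K3Index → ℂ))
    (hrat : ∀ v : K3Index → ℤ, ∃ w : K3Index → ℚ, σ (fun i => (v i : ℂ)) = fun i => (w i : ℂ))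
    (hσ : ∀ a b, k3Form (σ a) (σ b) = -(c : ℂ) * k3Form a b) : False := by
  obtain ⟨τ, hτ⟩ := exists_ratEnd_of_forall_intCast σ hrat
  refine k3FormRat_no_antisimilitude (c := -c) (by linarith) τ fun a b => ?_
  apply Rat.cast_injective (α := ℂ)
  rw [Rat.cast_mul, Rat.cast_neg, ← k3Form_ratCast, ← k3Form_ratCast, ← hτ a, ← hτ b, hσ]

/-- **A rational similitude of `(Λ_ℂ, k3Form)` of non-zero multiplier has a two-sided inverse
defined over `ℚ`.** It is injective (the form is non-degenerate, `det Λ_{K3} = -1`), hence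
bijective; its rational form `τ` (`exists_ratEnd_of_forall_intCast`) is an injective, hence
surjective, endomorphism of the `22`-dimensional `Λ_ℚ`, so the inverse maps `Λ` into `Λ_ℚ`.
[cite: Huybrechts2016K3, Ch. 14 §0.3 (vi)] -/
theorem exists_ratInverse_of_k3Form_similitude (σ : Module.End ℂ (K3Index → ℂ)) {c : ℂ}
    (hc : c ≠ 0) (hσ : ∀ a b, k3Form (σ a) (σ b) = c * k3Form a b)
    (hrat : ∀ v : K3Index → ℤ, ∃ w : K3Index → ℚ, σ (fun i => (v i : ℂ)) = fun i => (w i : ℂ)) :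
    ∃ N : Module.End ℂ (K3Index → ℂ),
      (∀ v : K3Index → ℤ, ∃ w : K3Index → ℚ, N (fun i => (v i : ℂ)) = fun i => (w i : ℂ)) ∧
      σ * N = 1 ∧ N * σ = 1 := by
  -- `σ` is injective: `σ a = 0 ⟹ c (a.b) = 0` for all `b`
  have hinj : Function.Injective σ := by
    refine (injective_iff_map_eq_zero σ).2 fun a ha => k3FormC_nondegenerate'.1 a fun b => ?_
    have h := hσ a b
    rw [ha, k3Form_zero_left] at h
    rw [k3FormC_apply]
    exact (mul_eq_zero.1 h.symm).resolve_left hc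
  have hbij : Function.Bijective σ := ⟨hinj, LinearMap.injective_iff_surjective.1 hinj⟩
  let e : (K3Index → ℂ) ≃ₗ[ℂ] (K3Index → ℂ) := LinearEquiv.ofBijective σ hbij
  have he : ∀ a, e a = σ a := fun a => rfl
  -- the rational form `τ` of `σ` is bijective on `Λ_ℚ`
  obtain ⟨τ, hτ⟩ := exists_ratEnd_of_forall_intCast σ hrat
  have hτinj : Function.Injective τ := by
    refine (injective_iff_map_eq_zero τ).2 fun u hu => ?_
    have h := hτ u
    rw [hu] at h
    have h0 : (fun i => (u i : ℂ)) = 0 := by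
      apply hinj
      rw [h, map_zero]
      funext i
      simp
    funext i
    have h' := congrFun h0 i
    simp only [Pi.zero_apply, Rat.cast_eq_zero] at h'
    simpa using h'
  have hτsurj : Function.Surjective τ := LinearMap.injective_iff_surjective.1 hτinj
  refine ⟨(e.symm : (K3Index → ℂ) →ₗ[ℂ] (K3Index → ℂ)), fun v => ?_, ?_, ?_⟩
  · obtain ⟨u, hu⟩ := hτsurj fun i => (v i : ℚ)
    refine ⟨u, ?_⟩
    apply e.injective
    rw [LinearEquiv.coe_coe, e.apply_symm_apply, he, hτ u]
    funext i
    rw [hu, Rat.cast_intCast]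
  · refine LinearMap.ext fun a => ?_
    rw [Module.End.mul_apply, Module.End.one_apply, LinearEquiv.coe_coe, ← he, e.apply_symm_apply]
  · refine LinearMap.ext fun a => ?_
    rw [Module.End.mul_apply, Module.End.one_apply, LinearEquiv.coe_coe, ← he, e.symm_apply_apply]
where
  /-- The complex K3 form is non-degenerate (`det Λ_{K3} = -1`). [cite: Huybrechts2016K3, Ch. 14 §0.3 (vi)] -/
  k3FormC_nondegenerate' : k3FormC.Nondegenerate := by
    refine LinearMap.BilinForm.nondegenerate_toBilin'_of_det_ne_zero' _ ?_
    have h : (k3Gram.map (Int.cast : ℤ → ℂ)).det = ((k3Gram.det : ℤ) : ℂ) :=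
      (Int.cast_det k3Gram).symm
    rw [h, k3Gram_det]
    norm_num

/-! ### The crux at multiplier `c` from twin transport at multiplier `c` — directly -/

/-- **The crux at a rational multiplier `c > 0` from the twin transport at multiplier `c`, granted
only the existence of markings** (no Buskin, no composition of correspondences, no surjectivity of
the period map). Let `ψ : H²(S′(ℂ); ℂ) → H²(S(ℂ); ℂ)` be rational, type-preserving and a
`c`-similitude for integral generators `p, p′` of `H⁴`. Mark `S, S′` (`Huybrechts_K3_marking_exists`:
`η, p₀, x` and `η′, p₀′, x′`, so `p = ±p₀`, `p′ = ±p₀′`). Then `M := η ∘ ψ ∘ η′⁻¹` is defined over `ℚ`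
(`markingConj_intCast`) and multiplies the K3 form by `±c` (`k3Form_markingConj_signed_mul`); the
sign `−` would make `M` a rational anti-similitude of `Λ_ℚ`, which the signature `(3,19)` forbids
(`not_ratAntisimilitude_k3Form`), so `M` is a rational `c`-similitude, with a rational two-sided
inverse (`exists_ratInverse_of_k3Form_similitude`). Since `ψ` carries the `(2,0)`-class `η′⁻¹ x′`
to a multiple of `η⁻¹ x`, `M x′ ∈ ℂ x`: the marked pair `(S, S′)` is an `M`-twin pair, and the twin
transport for `M` gives an algebraic `γ` with `η⁻¹ ∘ M ∘ η′ = [γ]_*`, i.e. `ψ = [γ]_*`.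
[cite: Buskin2019, §6.2 (similitudes induced via markings)] [cite: Varesco2023, §2]
[cite: Huybrechts2016K3, Ch. 1 Prop. 3.5, Ch. 6 Prop. 1.2, Ch. 14 §0.3 (vi)] -/
theorem simAlgAt_of_ratTwinTransportAt (hMk : Huybrechts_K3_marking_exists) (c : ℚ) (hc : 0 < c)
    (htw : RatTwinTransportAt[((c : ℚ) : ℂ)]) : SimAlgAt[((c : ℚ) : ℂ)] := by
  intro μ hμ S S' hS hS' p p' hp hp' ψ hrat htype hsim
  have hSK : IsK3Surface S := hS
  have hSK' : IsK3Surface S' := hS'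
  have hc0 : ((c : ℚ) : ℂ) ≠ 0 := by exact_mod_cast hc.ne'
  -- markings of the given surfaces
  obtain ⟨η, p₀, x, hp₀, hm, hx⟩ := hMk S hSK
  obtain ⟨η', p₀', x', hp₀', hm', hx'⟩ := hMk S' hSK'
  -- the generators of `H⁴` of the statement are those of the markings up to sign
  have hsg : p = p₀ ∨ p = -p₀ := eq_or_eq_neg_of_zsmul hp₀ (hp.2 p₀ hm.1) (hm.2.1 p hp.1)
  have hsg' : p' = p₀' ∨ p' = -p₀' :=
    eq_or_eq_neg_of_zsmul hp₀' (hp'.2 p₀' hm'.1) (hm'.2.1 p' hp'.1)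
  obtain ⟨s, hs, hs1⟩ : ∃ s : ℂ, p = s • p₀ ∧ (s = 1 ∨ s = -1) := by
    rcases hsg with hsg | hsg
    · exact ⟨1, by rw [hsg, one_smul], Or.inl rfl⟩
    · exact ⟨-1, by rw [hsg, neg_one_smul], Or.inr rfl⟩
  obtain ⟨s', hs', hs1'⟩ : ∃ s' : ℂ, p₀' = s' • p' ∧ (s' = 1 ∨ s' = -1) := by
    rcases hsg' with hsg' | hsg'
    · exact ⟨1, by rw [hsg', one_smul], Or.inl rfl⟩
    · exact ⟨-1, by rw [hsg', smul_neg, neg_one_smul, neg_neg], Or.inr rfl⟩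
  -- `M = η ∘ ψ ∘ η'⁻¹` is defined over `ℚ` and multiplies the K3 form by `s' s c`
  set M : Module.End ℂ (K3Index → ℂ) := η.toLinearMap ∘ₗ ψ ∘ₗ η'.symm.toLinearMap with hMdef
  have hMrat : ∀ v : K3Index → ℤ, ∃ w : K3Index → ℚ, M (fun i => (v i : ℂ)) = fun i => (w i : ℂ) :=
    markingConj_intCast hSK η hm.2.2.1 η' hm'.2.2.1 ψ hrat
  have hMform : ∀ a b, k3Form (M a) (M b) = s' * s * (c : ℂ) * k3Form a b :=
    k3Form_markingConj_signed_mul η p₀ p hp₀ s hs hm.2.2.2.1 η' p₀' p' s' hs' hm'.2.2.2.1 (c : ℂ) ψ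
      hsim
  -- the sign is `+`: an anti-similitude of `Λ_ℚ` does not exist
  have hss : s' * s = 1 := by
    rcases hs1 with rfl | rfl <;> rcases hs1' with rfl | rfl
    · norm_num
    · exact (not_ratAntisimilitude_k3Form c hc M hMrat fun a b => by rw [hMform]; ring).elim
    · exact (not_ratAntisimilitude_k3Form c hc M hMrat fun a b => by rw [hMform]; ring).elim
    · norm_num
  have hMc : ∀ a b, k3Form (M a) (M b) = ((c : ℚ) : ℂ) * k3Form a b := fun a b => by
    rw [hMform, hss, one_mul]
  -- a rational two-sided inverse
  obtain ⟨N, hNrat, hMN, hNM⟩ := exists_ratInverse_of_k3Form_similitude M hc0 hMc hMrat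
  -- the periods correspond under `M`, because `ψ` preserves the type `(2,0)`
  have hper : ∃ t : ℂ, M x' = t • x := by
    have h20 : IsOfHodgeType 2 S (2 * 1) 2 0 (ψ (η'.symm x')) := htype 2 0 _ hm'.2.2.2.2.1
    obtain ⟨t, ht⟩ := hm.2.2.2.2.2 _ h20
    refine ⟨t, ?_⟩
    rw [hMdef]
    simp only [LinearMap.coe_comp, LinearEquiv.coe_coe, Function.comp_apply]
    rw [ht, map_smul, LinearEquiv.apply_symm_apply]
  -- the twin transport for `M` on the `M`-twin pair `(S, S')`
  obtain ⟨γ, hγ, hγeq⟩ :=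
    htw M N hMrat hNrat hMN hNM hMc μ hμ S S' hSK hSK' η p₀ x η' p₀' x' hm hx hm' hx' hper
  refine ⟨γ, hγ, fun y => ?_⟩
  have hψ : ψ y = η.symm (M (η' y)) := by
    rw [hMdef]
    simp only [LinearMap.coe_comp, LinearEquiv.coe_coe, Function.comp_apply,
      LinearEquiv.symm_apply_apply]
  rw [hψ]
  exact hγeq y

/-- **Conversely, the crux at multiplier `c ≠ 0` gives the twin transport at multiplier `c`**
(granted the Hodge types of `H²(K3)`): `twinTransport_of_simAlgAt`, restated on
`RatTwinTransportAt[c]` (the inverse `N` is not even needed). [cite: Buskin2019, §6.2] -/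
theorem ratTwinTransportAt_of_simAlgAt (hHT : Huybrechts_K3_hodgeTypes_H2) (c : ℚ) (hc : c ≠ 0)
    (h : SimAlgAt[((c : ℚ) : ℂ)]) : RatTwinTransportAt[((c : ℚ) : ℂ)] :=
  fun M _N hMrat _ _ _ hMc => twinTransport_of_simAlgAt c hc hHT h M hMrat hMc

/-- **The crux at a rational multiplier `c > 0` IS the twin transport at multiplier `c`**, modulo
the marking fact (`⇐`) and the Hodge types of `H²(K3)` (`⇒`) — no Buskin, no composition of
correspondences, no surjectivity of the period map. [cite: Buskin2019, §6.2] [cite: Varesco2023, §2] -/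
theorem simAlgAt_iff_ratTwinTransportAt (hMk : Huybrechts_K3_marking_exists)
    (hHT : Huybrechts_K3_hodgeTypes_H2) (c : ℚ) (hc : 0 < c) :
    SimAlgAt[((c : ℚ) : ℂ)] ↔ RatTwinTransportAt[((c : ℚ) : ℂ)] :=
  ⟨ratTwinTransportAt_of_simAlgAt hHT c hc.ne', simAlgAt_of_ratTwinTransportAt hMk c hc⟩

/-! ### The crux, the target X and Buskin's item as lattice twin-transport statements -/

/-- **`HodgeSimilitudeAlgebraic` from twin transport at every positive rational multiplier**,
granted only the marking fact. [cite: Buskin2019, §6.2] [cite: Varesco2023, §2] -/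
theorem hodgeSimilitudeAlgebraic_of_forall_ratTwinTransportAt (hMk : Huybrechts_K3_marking_exists)
    (h : ∀ c : ℚ, 0 < c → RatTwinTransportAt[((c : ℚ) : ℂ)]) : HodgeSimilitudeAlgebraic :=
  fun r hr => simAlgAt_of_ratTwinTransportAt hMk r hr (h r hr)

/-- **THE CRUX IS TWIN TRANSPORT, multiplier by multiplier.** Modulo `Huybrechts_K3_marking_exists`
and `Huybrechts_K3_hodgeTypes_H2` only: every rational Hodge similitude of positive rational
multiplier between projective K3 surfaces is algebraic **iff** for every rational `c > 0` and every
rational `c`-similitude `M` of the K3 lattice (with rational two-sided inverse) the twin similitude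
`η⁻¹ ∘ M ∘ η′` is algebraic on every `M`-twin pair of marked projective K3 surfaces. Compare
`hodgeSimilitudeAlgebraic_iff_prime_twinTransport` (primes only, but modulo Buskin's item, the
composition of correspondences and period surjectivity in addition). [cite: Buskin2019, §6.2]
[cite: Varesco2023, §2] [cite: Huybrechts2016K3, Ch. 6 Prop. 1.2] -/
theorem hodgeSimilitudeAlgebraic_iff_forall_ratTwinTransportAt (hMk : Huybrechts_K3_marking_exists)
    (hHT : Huybrechts_K3_hodgeTypes_H2) :
    HodgeSimilitudeAlgebraic ↔ ∀ c : ℚ, 0 < c → RatTwinTransportAt[((c : ℚ) : ℂ)] :=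
  ⟨fun h c hc => ratTwinTransportAt_of_simAlgAt hHT c hc.ne' (h c hc),
    hodgeSimilitudeAlgebraic_of_forall_ratTwinTransportAt hMk⟩

/-- **Integer multipliers suffice, still without Buskin or composition**: twin transport for the
rational `n`-similitudes of `Λ_{K3}`, `n ≥ 1` an integer, gives the crux — `r = (num r · den r) /
(den r)²` and squares of rationals are free (`simAlgAt_div_sq`). [cite: Buskin2019, §6.2] -/
theorem hodgeSimilitudeAlgebraic_of_nat_ratTwinTransportAt (hMk : Huybrechts_K3_marking_exists)
    (h : ∀ n : ℕ, 0 < n → RatTwinTransportAt[((n : ℕ) : ℂ)]) : HodgeSimilitudeAlgebraic := by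
  intro r hr
  have hnum : 0 < r.num := Rat.num_pos.mpr hr
  have htoNat : 0 < r.num.toNat := by omega
  obtain ⟨m, hm⟩ : ∃ m : ℕ, m = r.num.toNat * r.den := ⟨_, rfl⟩
  have hmpos : 0 < m := hm ▸ Nat.mul_pos htoNat r.den_pos
  have hden : (r.den : ℚ) ≠ 0 := by exact_mod_cast r.den_ne_zero
  have hm' : ((m : ℕ) : ℚ) = r.num * r.den := by
    rw [hm, Nat.cast_mul]
    congr 1
    have h' : ((r.num.toNat : ℕ) : ℤ) = r.num := Int.toNat_of_nonneg hnum.le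
    exact_mod_cast h'
  have hq : ((m : ℕ) : ℚ) / (r.den : ℚ) ^ 2 = r := by
    rw [hm', sq, mul_div_mul_right _ _ hden, Rat.num_div_den]
  -- the crux at the integer multiplier `m`, then divide by `den²`
  have hmS : SimAlgAt[(((m : ℕ) : ℚ) : ℂ)] :=
    simAlgAt_of_ratTwinTransportAt hMk (m : ℚ) (by exact_mod_cast hmpos)
      (by rw [Rat.cast_natCast]; exact h m hmpos)
  rw [Rat.cast_natCast] at hmS
  have hcast : ((m : ℕ) : ℂ) / ((r.den : ℚ) : ℂ) ^ 2 = (r : ℂ) := by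
    have h2 := congrArg (Rat.cast : ℚ → ℂ) hq
    simpa only [Rat.cast_div, Rat.cast_pow, Rat.cast_natCast] using h2
  have hdiv := simAlgAt_div_sq ((m : ℕ) : ℂ) (r.den : ℚ) hden hmS
  rw [hcast] at hdiv
  exact hdiv

/-- **The crux ⟺ twin transport at every positive INTEGER multiplier**, modulo the two Huybrechts
facts. [cite: Buskin2019, §6.2] [cite: Varesco2023, §2] -/
theorem hodgeSimilitudeAlgebraic_iff_nat_ratTwinTransportAt (hMk : Huybrechts_K3_marking_exists)
    (hHT : Huybrechts_K3_hodgeTypes_H2) :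
    HodgeSimilitudeAlgebraic ↔ ∀ n : ℕ, 0 < n → RatTwinTransportAt[((n : ℕ) : ℂ)] := by
  refine ⟨fun h n hn => ?_, hodgeSimilitudeAlgebraic_of_nat_ratTwinTransportAt hMk⟩
  have h' := ratTwinTransportAt_of_simAlgAt hHT (n : ℚ) (by exact_mod_cast hn.ne')
    (h (n : ℚ) (by exact_mod_cast hn))
  rw [Rat.cast_natCast] at h'
  exact h'

/-- **The route's target X (`TwinSimilitudeAlgebraic`, stmt-HodgeConjecture-13674) ⟺ twin transport
for the rational `2`-similitudes of the K3 lattice**, modulo the two Huybrechts facts — and `⇐`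
modulo the marking fact alone: no Buskin, no composition of correspondences, no period
surjectivity (compare `twinSimilitudeAlgebraic_of_twinTransport`, which needs all three but only ONE
`M`). [cite: Buskin2019, §6.2] [cite: Varesco2023, §2] -/
theorem twinSimilitudeAlgebraic_iff_ratTwinTransportAt_two (hMk : Huybrechts_K3_marking_exists)
    (hHT : Huybrechts_K3_hodgeTypes_H2) :
    TwinSimilitudeAlgebraic ↔ RatTwinTransportAt[(2 : ℂ)] := by
  have h := simAlgAt_iff_ratTwinTransportAt hMk hHT 2 two_pos
  rw [show (((2 : ℚ)) : ℂ) = (2 : ℂ) by norm_num] at h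
  exact h

/-- **X from twin transport at multiplier `2` and the marking fact alone.** [cite: Varesco2023, §2] -/
theorem twinSimilitudeAlgebraic_of_ratTwinTransportAt_two (hMk : Huybrechts_K3_marking_exists)
    (h : RatTwinTransportAt[(2 : ℂ)]) : TwinSimilitudeAlgebraic := by
  have h2 := simAlgAt_of_ratTwinTransportAt hMk 2 two_pos
  rw [show (((2 : ℚ)) : ℂ) = (2 : ℂ) by norm_num] at h2
  exact h2 h

/-- **Buskin's item (`HodgeIsometryAlgebraic`, stmt-HodgeConjecture-13675) ⟺ twin transport for the
rational ISOMETRIES of the K3 lattice** (multiplier `1`), modulo the two Huybrechts facts: the graph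
of every rational lattice isometry is algebraic on every pair of marked projective K3 surfaces whose
periods it matches. [cite: Buskin2019, Thm. 1.1 and §6.2] -/
theorem hodgeIsometryAlgebraic_iff_ratTwinTransportAt_one (hMk : Huybrechts_K3_marking_exists)
    (hHT : Huybrechts_K3_hodgeTypes_H2) :
    HodgeIsometryAlgebraic ↔ RatTwinTransportAt[(1 : ℂ)] := by
  have h := simAlgAt_iff_ratTwinTransportAt hMk hHT 1 one_pos
  rw [show (((1 : ℚ)) : ℂ) = (1 : ℂ) by norm_num] at h
  exact simAlgAt_one_iff.symm.trans h

end Summit.HodgeConjecture.HodgeConjecture.Theorems.NikulinTwinTransport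

end
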